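import Summits.QuantumFields.YangMills.Theorems.AllWindowsColdBoxBoxHighLineEventInsideFP
import Summits.QuantumFields.YangMills.Theorems.AllWindowsColdBoxBoxHighLineCubicVertexPoly
import Summits.QuantumFields.YangMills.Theorems.AllWindowsColdBoxBoxHighLineGaussCovMainReduction

/-!
# `CubicCutInsideFP` (U5-BLOCKERS §2 L4 «probabilistic cubic cut», planner ym-idea-2 g18) — the cubic vertex is rarely large INSIDE the FP chart weight
# (LINE-20 U5 ⟨stmt-QuantumFields-24336⟩ `stub_landauThirdOrder`; U5 prep, helper-grade; U5 OPEN)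

Width seat `ym-line-sfw-p2-w4` (prover-ym-line-sfw-p2-w4-g29-0).  The one-liner announced on the bus (22:23Z): w4's ✓`SmallFieldFP.eventInsideFP`
(the T-S5.6 domination trick for an arbitrary event inside the small field `D = smallField H s`) at the event
`E = {a | λ + C₅·β·H⁴·s⁵ ≤ |cubicVertex β H a|}`, fed with w5 g23's ✓`EdgeChartGaussian.gaussAvg_sfInd_mul_indicator_cubicVertex_le` (the Gaussian
tail of the cubic vertex on `D` through its cubic Taylor polynomial, every moment order `k ≥ 1`) at EVERY chart Gaussian `β′ ∈ [β/2, 2β]`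
(homogeneity `cubicVertex β′ H = (β′/β)·cubicVertex β H`, so the event is the same at the rescaled level `λ′ = (β′/β)λ`; the `β′`-uniform bound costs `8^k`):

  ★ **`SmallFieldFP.cubicCutInsideFP`**: with `p_k := (2k−1)^{3k}·(8C₅·H⁴(1+log H)³/β)^k/λ^{2k} ≤ 1/4`,
  `∫_{D ∩ E} w_J ≤ 2·e^{C·s·H⁵}·p_k·∫_{D ∖ E} w_J` (`w_J = fpChartWeight β H r`; `H ≥ 1`, `β > 0`, `0 < s ≤ r`, `s·H² ≤ c₀`, `C(1+log H) ≤ βs²`, `λ > 0`).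

In the U5 letters (`s = β^{−1/2+κ₃}`, `H ≍ β^θ`, `λ = 1`): the shift `C₅βH⁴s⁵ = C₅β^{4θ+5κ₃−3/2} → 0`, `p_k ≍ β^{−k(1−4θ)}·polylog`, and the bracket
`e^{C s H⁵} = e^{Cβ^{5θ−1/2+κ₃}}`; choosing `k` (and the exponents) is the U5 assembler's.  Everything proved; no definitions; standard axioms.
HONEST LABEL: U5 prep, helper-grade, for the RECORDED, UNSTAFFED lift L4; U5 ⟨24336⟩, ⟨24004⟩ and the seat's own crux ⟨22884⟩ remain OPEN; no stub is
closed by name, no crux, rung or summit is proved; **the Yang–Mills mass gap is NOT proved by this file; no summit is proved by a line.**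
-/

set_option autoImplicit false

open MeasureTheory Real Finset

namespace Summit.QuantumFields.YangMills.Theorems.AllWindowsColdBoxBoxHighLine

namespace SmallFieldFP

variable {H : ℕ}

/-- Homogeneity of the cubic vertex in `β`: `cubicVertex β′ H a = (β′/β)·cubicVertex β H a` (`β ≠ 0`). -/
theorem cubicVertex_rescale {β β' : ℝ} (hβ : β ≠ 0) (a : LandauFree H → E3) :
    cubicVertex β' H a = β' / β * cubicVertex β H a := by
  unfold cubicVertex
  rw [← mul_assoc, div_mul_cancel₀ β' hβ]

/-- The cubic-cut event is the same at every Gaussian level after rescaling the threshold: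
`{λ + C·β·H⁴·s⁵ ≤ |V₃^β|} = {(β′/β)λ + C·β′·H⁴·s⁵ ≤ |V₃^{β′}|}` (`0 < β`, `0 < β′`). -/
theorem cubicCut_event_rescale {β β' C s lam : ℝ} (hβ : 0 < β) (hβ' : 0 < β') :
    {a : LandauFree H → E3 | lam + C * β * (H : ℝ) ^ 4 * s ^ 5 ≤ |cubicVertex β H a|} =
      {a : LandauFree H → E3 | β' / β * lam + C * β' * (H : ℝ) ^ 4 * s ^ 5 ≤ |cubicVertex β' H a|} := by
  ext a
  simp only [Set.mem_setOf_eq]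
  rw [cubicVertex_rescale (β := β) (β' := β') hβ.ne' a, abs_mul, abs_of_pos (div_pos hβ' hβ)]
  have hk : 0 < β' / β := div_pos hβ' hβ
  have hid : β' / β * lam + C * β' * (H : ℝ) ^ 4 * s ^ 5 = β' / β * (lam + C * β * (H : ℝ) ^ 4 * s ^ 5) := by
    field_simp
  rw [hid]
  exact ⟨fun h => mul_le_mul_of_nonneg_left h hk.le, fun h => le_of_mul_le_mul_left h hk⟩

/-- The cubic-cut event is measurable. -/
theorem measurableSet_cubicCut (β C s lam : ℝ) :
    MeasurableSet {a : LandauFree H → E3 | lam + C * β * (H : ℝ) ^ 4 * s ^ 5 ≤ |cubicVertex β H a|} := by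
  have hm : Measurable (cubicVertex β H) := by
    unfold cubicVertex
    exact (Finset.measurable_sum _ fun p _ => EdgeChartGaussian.measurable_chartPlaqCostOdd H p.1 p.2.1.1 p.2.1.2).const_mul β
  exact measurableSet_le measurable_const hm.abs

/-- The `β′`-uniform tail arithmetic: for `β/2 ≤ β′`, `M·(X/β′)^k / ((β′/β)·λ)^{2k} ≤ M·(8X/β)^k / λ^{2k}` (`M, X ≥ 0`, `β, λ > 0`, `k : ℕ`). -/
theorem tail_rescale_le {M X β β' lam : ℝ} (k : ℕ) (hM : 0 ≤ M) (hX : 0 ≤ X) (hβ : 0 < β) (hlam : 0 < lam) (hlo : β / 2 ≤ β') :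
    M * (X / β') ^ k / (β' / β * lam) ^ (2 * k) ≤ M * (8 * X / β) ^ k / lam ^ (2 * k) := by
  have hβ' : 0 < β' := lt_of_lt_of_le (by linarith) hlo
  have hu0 : 0 < β / β' := div_pos hβ hβ'
  have hu : β / β' ≤ 2 := by rw [div_le_iff₀ hβ']; linarith
  have e1 : X / β' = X / β * (β / β') := by field_simp
  have e2 : β' / β * lam = lam / (β / β') := by field_simp
  have core : (X / β') ^ k / (β' / β * lam) ^ (2 * k) ≤ (8 * X / β) ^ k / lam ^ (2 * k) := by
    rw [e1, e2, mul_pow (X / β) (β / β') k, div_pow lam (β / β') (2 * k), div_div_eq_mul_div]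
    refine div_le_div_of_nonneg_right ?_ (pow_nonneg hlam.le _)
    have h3 : (β / β') ^ k * (β / β') ^ (2 * k) ≤ (8 : ℝ) ^ k := by
      rw [← pow_add, show k + 2 * k = 3 * k by ring, pow_mul]
      have h8 : (β / β') ^ 3 ≤ 8 := by
        calc (β / β') ^ 3 ≤ 2 ^ 3 := pow_le_pow_left₀ hu0.le hu 3
          _ = 8 := by norm_num
      exact pow_le_pow_left₀ (by positivity) h8 k
    calc (X / β) ^ k * (β / β') ^ k * (β / β') ^ (2 * k) = (X / β) ^ k * ((β / β') ^ k * (β / β') ^ (2 * k)) := by ring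
      _ ≤ (X / β) ^ k * (8 : ℝ) ^ k := mul_le_mul_of_nonneg_left h3 (by positivity)
      _ = (8 * X / β) ^ k := by rw [← mul_pow]; congr 1; ring
  calc M * (X / β') ^ k / (β' / β * lam) ^ (2 * k) = M * ((X / β') ^ k / (β' / β * lam) ^ (2 * k)) := mul_div_assoc _ _ _
    _ ≤ M * ((8 * X / β) ^ k / lam ^ (2 * k)) := mul_le_mul_of_nonneg_left core hM
    _ = M * (8 * X / β) ^ k / lam ^ (2 * k) := (mul_div_assoc _ _ _).symm

/-- ★ **`CubicCutInsideFP`** — inside the Faddeev–Popov chart weight, on the small field `D = smallField H s`, the cubic vertex is rarely large: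
with `E = {λ + C₅βH⁴s⁵ ≤ |cubicVertex β H ·|}` and `p_k = (2k−1)^{3k}(8C₅H⁴(1+log H)³/β)^k/λ^{2k} ≤ 1/4`,
`∫_{D ∩ E} w_J ≤ 2·e^{C·s·H⁵}·p_k·∫_{D ∖ E} w_J`. -/
theorem cubicCutInsideFP :
    ∃ C C₅ c₀ : ℝ, 0 < c₀ ∧ 0 ≤ C₅ ∧ ∀ H : ℕ, 1 ≤ H → ∀ β r s : ℝ, 0 < β → 0 < s → s ≤ r → s * (H : ℝ) ^ 2 ≤ c₀ →
      C * (1 + Real.log H) ≤ β * s ^ 2 → ∀ lam : ℝ, 0 < lam → ∀ k : ℕ, 1 ≤ k →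
      (2 * k - 1 : ℝ) ^ (k * 3) * (8 * (C₅ * (H : ℝ) ^ 4 * (1 + Real.log H) ^ 3) / β) ^ k / lam ^ (2 * k) ≤ 1 / 4 →
        ∫ a in smallField H s ∩ {a | lam + C₅ * β * (H : ℝ) ^ 4 * s ^ 5 ≤ |cubicVertex β H a|}, fpChartWeight β H r a ≤
          2 * Real.exp (C * s * (H : ℝ) ^ 5) *
            ((2 * k - 1 : ℝ) ^ (k * 3) * (8 * (C₅ * (H : ℝ) ^ 4 * (1 + Real.log H) ^ 3) / β) ^ k / lam ^ (2 * k)) *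
            ∫ a in smallField H s \ {a | lam + C₅ * β * (H : ℝ) ^ 4 * s ^ 5 ≤ |cubicVertex β H a|}, fpChartWeight β H r a := by
  obtain ⟨C, c₀, hc₀, hE⟩ := eventInsideFP
  obtain ⟨C₅, hC₅, h5⟩ := EdgeChartGaussian.gaussAvg_sfInd_mul_indicator_cubicVertex_le
  refine ⟨C, C₅, c₀, hc₀, hC₅, ?_⟩
  intro H hH β r s hβ hs hsr hsH hCβ lam hlam k hk hp4
  set E : Set (LandauFree H → E3) := {a | lam + C₅ * β * (H : ℝ) ^ 4 * s ^ 5 ≤ |cubicVertex β H a|} with hEdef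
  set p : ℝ := (2 * k - 1 : ℝ) ^ (k * 3) * (8 * (C₅ * (H : ℝ) ^ 4 * (1 + Real.log H) ^ 3) / β) ^ k / lam ^ (2 * k) with hpdef
  have hEm : MeasurableSet E := measurableSet_cubicCut β C₅ s lam
  have hAm : MeasurableSet (smallField H s ∩ E) := (ChartGauss.measurableSet_smallField s).inter hEm
  -- the Gaussian input at every `β′ ∈ [β/2, 2β]`
  have hgauss : ∀ β' : ℝ, β / 2 ≤ β' → β' ≤ 2 * β →
      gaussAvg β' H ((smallField H s ∩ E).indicator fun _ => (1 : ℝ)) ≤ p := by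
    intro β' hlo hhi
    have hβ' : 0 < β' := lt_of_lt_of_le (by linarith) hlo
    have hlam' : 0 < β' / β * lam := mul_pos (div_pos hβ' hβ) hlam
    have h := h5 H hH β' hβ' s hs.le (β' / β * lam) hlam' k hk
    -- the event at level `β′` is `E`
    rw [← cubicCut_event_rescale hβ hβ'] at h
    have hfun : ((smallField H s ∩ E).indicator fun _ => (1 : ℝ)) =
        fun a => sfInd H s a * E.indicator (fun _ => (1 : ℝ)) a := by
      funext a
      rw [← Set.indicator_indicator]
      unfold sfInd
      by_cases h1 : a ∈ smallField H s
      · rw [Set.indicator_of_mem h1, Set.indicator_of_mem h1, one_mul]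
      · rw [Set.indicator_of_notMem h1, Set.indicator_of_notMem h1, zero_mul]
    rw [hfun]
    refine h.trans ?_
    have hX : 0 ≤ C₅ * (H : ℝ) ^ 4 * (1 + Real.log H) ^ 3 := by
      have hH' : (1 : ℝ) ≤ H := by exact_mod_cast hH
      have := Real.log_nonneg hH'
      positivity
    have hk0 : 0 ≤ (2 * k - 1 : ℝ) ^ (k * 3) := by
      have : (1 : ℝ) ≤ 2 * k - 1 := by
        have : (1 : ℝ) ≤ k := by exact_mod_cast hk
        linarith
      positivity
    exact tail_rescale_le k hk0 hX hβ hlam hlo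
  have hmain := hE H hH β r s hβ hs hsr hsH hCβ (smallField H s ∩ E) hAm p hp4 hgauss
  have hset1 : smallField H s ∩ (smallField H s ∩ E) = smallField H s ∩ E := by
    rw [← Set.inter_assoc, Set.inter_self]
  have hset2 : smallField H s \ (smallField H s ∩ E) = smallField H s \ E := Set.sdiff_self_inter
  rw [hset1, hset2] at hmain
  exact hmain

end SmallFieldFP

end Summit.QuantumFields.YangMills.Theorems.AllWindowsColdBoxBoxHighLine
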